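import Summits.QuantumFields.BalabanUV.T4Continuum.Support.GramPerturbationLaw
import Summits.QuantumFields.BalabanUV.T4Continuum.Support.BalabanAveragingPairing
import Summits.QuantumFields.BalabanUV.T4Continuum.Support.CovariantLinePlanting

/-!
# T⁴ programme, spine node NE2 (U1a) — BAŁABAN's LINE-AVERAGED COVARIANT VECTOR AVERAGING (tier B, row B3.a-vec of
# `t4/b2b-balaban-t4-ne2-p1/B-CLAIM-TABLE-NE2-P1.md`): the ONE-STEP covariant line-block average, its planting identity against
# King's pairing, and the block averages it produces

NE2 formalisation swarm, seat `b2b-balaban-t4-ne2-formalise-leaf-02`, file 2 of 3 of row B3.a-vec (file 1 = `Support/CovariantLinePlanting`: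
`par_add_tstep`, the planting identity `shiftT_mul_JK` for `t < R` own-direction steps, block averages `bavg`, the block-average identity
and the averaged families `Tgen`, `Wgen`).  The `Q` that sits inside Bałaban's
`Δ_a` ([Balaban1984PropagatorsI] (1.69)) is the LINE-AVERAGED block averaging (1.11)/(1.18) (`BalabanLineAverage.QB = Qavg·Lavg`, line
factor `v_μ` of (1.61)); its covariant version ([Balaban1985Averaging] (124)/(125), the main term `(Q_{V₀}A)_c = Σ_{x∈B(c₋)} L^{−(d+1)}
R(V₀; c, x)·A([x, x(c)])`: the bond variables along the `μ`-line are transported back along the line to its start `x`, then along the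
block contour to the block base point) is modelled here, with ALL transporters as DATA (trigger condition c5 — no assertion of the
dictionary B0), by the ONE-STEP operator on `(sites × components) × colours`
  `Qc T Rl := (Qavg ⊗ₖ 1) · siteMul T · Lc Rl`,  `Lc Rl := R⁻¹ • Σ_{t<R} siteMul (Rl t) · (shiftT t ⊗ₖ 1)`
(`shiftT t` = `BalabanLineAverage.shiftT`, the own-direction translation by `t` fine steps; `Rl t x` = the line transporter over the
first `t` bonds of the line at `x`; `T x` = the block transporter from `x` to the base point of its block).  At `T = 1`, `Rl = 1` it is
`QB ⊗ₖ 1` EXACTLY (`Qc_one_one`).  This file proves, at two levels `(N, R)`: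
 * §4 (numbering continues file 1) the objects `Lc`, `Qc` (`Lc_one`, `Qc_one_one`) and **`sqrt_smul_Qc_mul_kronJK`**: `√(R^d)•Qc·(J_R ⊗ 1) = siteMul (Tbar) + siteMul (W)·((S_1 − 1) ⊗ 1)` with
   `Tbar = R⁻¹Σ_t bavg (T·Rl t)`, `W = R⁻¹Σ_t bavg (𝟙_{F_t}·T·Rl t)`: the coarse field seen through one covariant averaging step and
   King's planting is a block-averaged transporter PLUS a term carrying one coarse difference `S_1 − 1 = c⁻¹Σ_μ P_μ∇_μ` — at
   `T = Rl = 1` the latter is the free pairing defect of `QB`; `‖Tbar − 1‖∞, ‖W − W⁰‖∞ ≤ sup‖T·Rl t − 1‖`, `‖W‖∞ ≤ 1`.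
 * §5 operator norms (`‖Lc‖ ≤ 1`, `‖Qc‖² ≤ R^{−d}`, **`opNorm_sqrt_smul_Qc_sub_Qc_le`**: `‖√(R^d)•(Qc T′ Rl′ − Qc T Rl)‖ ≤ ‖T′ − T‖∞ +
   ‖Rl′ − Rl‖∞` for contraction transporters — two backgrounds / two depths; `‖√(R^d)•(Qc − QB ⊗ 1)‖ ≤ α + β` as the case `T = Rl = 1`),
   THE TWO-LEVEL IDENTITY **`twoLevel_identity`**
   `(Bx·√•Qc − Bb·√•(QB⊗1))·(J⊗1) − (Bx − Bb) = Bx·siteMul(T̄ − 1) + ((Bx − Bb)·siteMul W + Bb·siteMul(W − W⁰))·((S_1 − 1)⊗1)` for arbitrary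
   left factors (the covariant / free composites of the coarser steps) and its SANDWICHED BOUND **`twoLevel_bound`** (`_left`):
   `≤ (α + β)·Cst + (ε + α + β)·d·Cst/N` against `𝒢^{(N)} ⊗ 1`, by (1.89) `‖∇_μ𝒢‖ ≤ Cst` alone (`BalabanLineAverage.opNorm_shiftT_one_sub_one_mul_le`).
File 3 (`Support/CovariantLineAveragingTower`) composes the steps along the tower (`GramPerturbationLaw.Btow`) and derives
`GramPerturbationLaw.AveragingLaws` for `E = Btow(Qc) − Btow(QB ⊗ 1)` with GEOMETRIC sandwiched pairings, and the Gram row.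

HONEST FRAMING (T4-DAG p. 1).  Exact finite lattice bookkeeping + operator-norm bounds; transporters are DATA (no group structure, no
contour is constructed here); the remainder terms of [Balaban1985Averaging] (124) (the `g`-functions, `O(L²α₀)`) are NOT modelled; rates /
pairings / constants OURS; NOT [B7] (124) or [B9] (3.26) as printed; NE2 NOT proved; NOT infinite volume / mass gap / Clay / summit
progress; spine 0/9 unchanged.  HONEST DEPENDENCY: continuum YM on T⁴ ⇐ BetaPertH ∧ nine spine estimates (0/9 proved); BetaPertH ⇐ (D1)
∧ (D4) ∧ CAP+tail; G-an2-4 gates asym, D1 and NE2/3/4.  ABSOLUTE RULE kept; no `sorry`.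
-/

noncomputable section

open scoped BigOperators ComplexConjugate Matrix Matrix.Norms.L2Operator Kronecker

namespace Summit.QuantumFields.BalabanUV.T4Continuum.CovariantLineAveraging

open Literature.MathematicalPhysics.QuantumFieldTheory.Balaban1983to89.B5Prop11Plancherel (fine Tor calG Cst Cst_nonneg opNorm_calG_le
  opNorm_fdiff_calG_le calG_isHermitian)
open Literature.MathematicalPhysics.QuantumFieldTheory.Balaban1983to89.B5G183RateTorusW (Qavg opNorm_Qavg_le)
open Summit.QuantumFields.BalabanUV.T4Continuum
open Summit.QuantumFields.BalabanUV.T4Continuum.KingPairingPlantedLaw (JK)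
open Summit.QuantumFields.BalabanUV.T4Continuum.BlockMultiplication
open Summit.QuantumFields.BalabanUV.T4Continuum.KroneckerLift
open Summit.QuantumFields.BalabanUV.T4Continuum.KroneckerUnits (sum_kronecker)
open Summit.QuantumFields.BalabanUV.T4Continuum.BalabanLineAverage (shiftT Lavg QB)
open Summit.QuantumFields.BalabanUV.T4Continuum.ColourCovariantLaplacian (siteMul_finset_sum)
open Summit.QuantumFields.BalabanUV.T4Continuum.CovariantLinePlanting

variable {d : ℕ}

/-! ## §4 The one-step covariant line-block average and its planting identity -/

section OneStep

variable (N R : ℕ) [NeZero N] [NeZero R] (M : Fin d → ℕ) [hM : ∀ μ, NeZero (M μ)] {o : Type*} [Fintype o] [DecidableEq o]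

omit [Fintype o] in
/-- a scalar diagonal lifted to colours is a site multiplication by scalar colour matrices. [folklore] -/
theorem kron_diagonal_one {ι : Type*} [DecidableEq ι] (χ : ι → ℂ) :
    Matrix.diagonal χ ⊗ₖ (1 : Matrix o o ℂ) = siteMul fun i => χ i • (1 : Matrix o o ℂ) := by
  ext p q
  rw [Matrix.kroneckerMap_apply, Matrix.diagonal_apply, siteMul_apply]
  by_cases h : p.1 = q.1
  · rw [if_pos h, if_pos h, Matrix.smul_apply, smul_eq_mul]
  · rw [if_neg h, if_neg h, zero_mul]

/-- **THE COVARIANT LINE AVERAGE** with line transporters `Rl t` (over the first `t` bonds of the own-direction line at each site):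
`Lc Rl = R⁻¹ Σ_{t<R} siteMul (Rl t)·(S_t ⊗ 1)` — at `Rl = 1` the straight-contour average `Lavg ⊗ 1` of (1.11)/(1.18).
[cite: Balaban1985Averaging, (125) p.36 (shape «A([x, x(c)])» transported); Balaban1984PropagatorsI, (1.18) p.20] [folklore] -/
def Lc (Rl : Fin R → Tor (fine (R * N) M) × Fin d → Matrix o o ℂ) :
    Matrix ((Tor (fine (R * N) M) × Fin d) × o) ((Tor (fine (R * N) M) × Fin d) × o) ℂ :=
  ((R : ℂ))⁻¹ • ∑ t : Fin R, siteMul (Rl t) * (shiftT (fine (R * N) M) (t : ℕ) ⊗ₖ (1 : Matrix o o ℂ))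

/-- **THE ONE-STEP COVARIANT LINE-BLOCK AVERAGE** `Qc T Rl = (Q_R ⊗ 1)·siteMul T·Lc Rl`: covariant line average, then transport
`T` to the block base point, then the block average — the main-term shape of [Balaban1985Averaging] (124)/(125) with all transporters
as DATA. [cite: Balaban1985Averaging, (125) p.36 (shape)] [folklore] -/
def Qc (T : Tor (fine (R * N) M) × Fin d → Matrix o o ℂ) (Rl : Fin R → Tor (fine (R * N) M) × Fin d → Matrix o o ℂ) :
    Matrix ((Tor (fine N M) × Fin d) × o) ((Tor (fine (R * N) M) × Fin d) × o) ℂ :=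
  (Qavg N R M ⊗ₖ (1 : Matrix o o ℂ)) * siteMul T * Lc N R M Rl

/-- at `Rl = 1` the covariant line average is `Lavg ⊗ 1`. [folklore] -/
theorem Lc_one : Lc N R M (fun (_ : Fin R) (_ : Tor (fine (R * N) M) × Fin d) => (1 : Matrix o o ℂ))
    = Lavg (fine (R * N) M) R ⊗ₖ (1 : Matrix o o ℂ) := by
  rw [Lc, Lavg, Matrix.smul_kronecker, sum_kronecker]
  congr 1
  refine Finset.sum_congr rfl fun t _ => ?_
  rw [siteMul_one, Matrix.one_mul]

/-- **at `T = 1`, `Rl = 1` the one-step covariant average IS Bałaban's `QB ⊗ 1`** (by construction; no dictionary asserted). [folklore] -/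
theorem Qc_one_one : Qc N R M (fun _ => (1 : Matrix o o ℂ)) (fun (_ : Fin R) _ => (1 : Matrix o o ℂ))
    = QB N R M ⊗ₖ (1 : Matrix o o ℂ) := by
  rw [Qc, Lc_one, siteMul_one, Matrix.mul_one, QB, kron_mul]

/-- **THE PLANTING IDENTITY OF THE ONE-STEP COVARIANT LINE-BLOCK AVERAGE**:
`√(R^d)•Qc T Rl·(J_R ⊗ 1) = siteMul (Tgen (T·Rl)) + siteMul (Wgen (T·Rl))·((S_1 − 1) ⊗ 1)`. [folklore] -/
theorem sqrt_smul_Qc_mul_kronJK (T : Tor (fine (R * N) M) × Fin d → Matrix o o ℂ)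
    (Rl : Fin R → Tor (fine (R * N) M) × Fin d → Matrix o o ℂ) :
    ((((Real.sqrt ((R : ℝ) ^ d)) : ℝ) : ℂ)) • (Qc N R M T Rl * (JK N R M ⊗ₖ (1 : Matrix o o ℂ)))
      = siteMul (Tgen N R M (fun t x => T x * Rl t x))
        + siteMul (Wgen N R M (fun t x => T x * Rl t x)) * ((shiftT (fine N M) 1 - 1) ⊗ₖ (1 : Matrix o o ℂ)) := by
  set s : ℂ := (((Real.sqrt ((R : ℝ) ^ d)) : ℝ) : ℂ) with hs
  set Q1 := Qavg N R M ⊗ₖ (1 : Matrix o o ℂ) with hQ1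
  set J1 := JK N R M ⊗ₖ (1 : Matrix o o ℂ) with hJ1
  set X := (shiftT (fine N M) 1 - 1) ⊗ₖ (1 : Matrix o o ℂ) with hX
  -- step 1: each `t`-term through the planting
  have step : ∀ t : Fin R,
      s • (Q1 * siteMul T * (siteMul (Rl t) * (shiftT (fine (R * N) M) (t : ℕ) ⊗ₖ (1 : Matrix o o ℂ))) * J1)
        = siteMul (bavg N R M (fun x => T x * Rl t x))
          + siteMul (bavg N R M (fun x => ind N R M (t : ℕ) x • (T x * Rl t x))) * X := by
    intro t
    have hplant : shiftT (fine (R * N) M) (t : ℕ) ⊗ₖ (1 : Matrix o o ℂ) * J1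
        = J1 + siteMul (fun x => ind N R M (t : ℕ) x • (1 : Matrix o o ℂ)) * J1 * X := by
      rw [hJ1, hX, ← kron_mul, shiftT_mul_JK N R M t.isLt, Matrix.add_kronecker, kron_mul, kron_mul, offInd_eq,
        kron_diagonal_one]
    have hmul : siteMul (fun x => T x * Rl t x) * siteMul (fun x => ind N R M (t : ℕ) x • (1 : Matrix o o ℂ))
        = siteMul (fun x => ind N R M (t : ℕ) x • (T x * Rl t x)) := by
      rw [siteMul_mul]
      congr 1
      funext x
      rw [Matrix.mul_smul, Matrix.mul_one]
    calc s • (Q1 * siteMul T * (siteMul (Rl t) * (shiftT (fine (R * N) M) (t : ℕ) ⊗ₖ (1 : Matrix o o ℂ))) * J1)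
        = s • (Q1 * (siteMul T * siteMul (Rl t)) * (shiftT (fine (R * N) M) (t : ℕ) ⊗ₖ (1 : Matrix o o ℂ) * J1)) := by
          simp only [Matrix.mul_assoc]
      _ = s • (Q1 * siteMul (fun x => T x * Rl t x) * J1)
          + s • (Q1 * (siteMul (fun x => T x * Rl t x) * siteMul (fun x => ind N R M (t : ℕ) x • (1 : Matrix o o ℂ))) * J1)
              * X := by
          rw [siteMul_mul, hplant, Matrix.mul_add, smul_add]
          simp only [Matrix.mul_assoc, Matrix.smul_mul]
      _ = _ := by rw [hmul, hQ1, hJ1, sqrt_smul_kronQavg_siteMul_kronJK, sqrt_smul_kronQavg_siteMul_kronJK]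
  -- step 2: sum over `t`
  have e1 : Qc N R M T Rl * J1
      = ((R : ℂ))⁻¹ • ∑ t : Fin R, Q1 * siteMul T * (siteMul (Rl t) * (shiftT (fine (R * N) M) (t : ℕ) ⊗ₖ (1 : Matrix o o ℂ))) * J1 := by
    rw [Qc, Lc, ← hQ1, Matrix.mul_smul, Matrix.smul_mul, Matrix.mul_sum, Matrix.sum_mul]
  rw [e1, smul_comm, Finset.smul_sum]
  simp_rw [step]
  rw [Finset.sum_add_distrib, smul_add, ← Finset.sum_mul, ← Matrix.smul_mul, siteMul_finset_sum, siteMul_finset_sum,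
    ← siteMul_smul, ← siteMul_smul]
  rfl

end OneStep

/-! ## §5 Operator norms of the one-step objects and the two-level identity with its sandwiched bound -/

section Norms

variable (N R : ℕ) [NeZero N] [NeZero R] (M : Fin d → ℕ) [hM : ∀ μ, NeZero (M μ)] {o : Type*} [Fintype o] [DecidableEq o]

/-- `‖Lc Rl‖ ≤ 1` for contraction line transporters. [folklore] -/
theorem opNorm_Lc_le {Rl : Fin R → Tor (fine (R * N) M) × Fin d → Matrix o o ℂ} (hR : ∀ t x, ‖Rl t x‖ ≤ 1) :
    ‖Lc N R M Rl‖ ≤ 1 := by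
  have hRpos : (0 : ℝ) < R := by exact_mod_cast Nat.pos_of_ne_zero (NeZero.ne R)
  rw [Lc, norm_smul, norm_inv, Complex.norm_natCast]
  calc (R : ℝ)⁻¹ * ‖∑ t : Fin R, siteMul (Rl t) * shiftT (fine (R * N) M) (t : ℕ) ⊗ₖ (1 : Matrix o o ℂ)‖
      ≤ (R : ℝ)⁻¹ * ∑ t : Fin R, ‖siteMul (Rl t) * shiftT (fine (R * N) M) (t : ℕ) ⊗ₖ (1 : Matrix o o ℂ)‖ :=
        mul_le_mul_of_nonneg_left (norm_sum_le _ _) (inv_nonneg.mpr hRpos.le)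
    _ ≤ (R : ℝ)⁻¹ * ∑ _t : Fin R, (1 : ℝ) := by
        refine mul_le_mul_of_nonneg_left (Finset.sum_le_sum fun t _ => ?_) (inv_nonneg.mpr hRpos.le)
        calc _ ≤ ‖siteMul (Rl t)‖ * ‖shiftT (fine (R * N) M) (t : ℕ) ⊗ₖ (1 : Matrix o o ℂ)‖ := Matrix.l2_opNorm_mul _ _
          _ ≤ 1 * 1 := mul_le_mul (opNorm_siteMul_le _ zero_le_one (hR t))
              (opNorm_kron_le_of_le o (BalabanLineAverage.opNorm_shiftT_le _ _)) (norm_nonneg _) zero_le_one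
          _ = 1 := one_mul 1
    _ = 1 := by rw [Finset.sum_const, Finset.card_univ, Fintype.card_fin, nsmul_eq_mul, mul_one, inv_mul_cancel₀ hRpos.ne']

/-- `‖Qc T Rl‖² ≤ R^{−d}` for contraction transporters (the normalisation `GramPerturbationLaw.Btow` wants). [folklore] -/
theorem opNorm_Qc_sq_le {T : Tor (fine (R * N) M) × Fin d → Matrix o o ℂ} {Rl : Fin R → Tor (fine (R * N) M) × Fin d → Matrix o o ℂ}
    (hT : ∀ x, ‖T x‖ ≤ 1) (hR : ∀ t x, ‖Rl t x‖ ≤ 1) : ‖Qc N R M T Rl‖ ^ 2 ≤ ((R : ℝ) ^ d)⁻¹ := by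
  have hRd : (0 : ℝ) < (R : ℝ) ^ d := pow_pos (by exact_mod_cast Nat.pos_of_ne_zero (NeZero.ne R)) d
  have hs : 0 ≤ (Real.sqrt ((R : ℝ) ^ d))⁻¹ := inv_nonneg.mpr (Real.sqrt_nonneg _)
  have h1 : ‖Qc N R M T Rl‖ ≤ (Real.sqrt ((R : ℝ) ^ d))⁻¹ := by
    rw [Qc]
    calc _ ≤ ‖Qavg N R M ⊗ₖ (1 : Matrix o o ℂ) * siteMul T‖ * ‖Lc N R M Rl‖ := Matrix.l2_opNorm_mul _ _
      _ ≤ ((Real.sqrt ((R : ℝ) ^ d))⁻¹ * 1) * 1 := by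
          refine mul_le_mul ((Matrix.l2_opNorm_mul _ _).trans (mul_le_mul (opNorm_kron_le_of_le o (opNorm_Qavg_le N R M))
            (opNorm_siteMul_le _ zero_le_one hT) (norm_nonneg _) hs)) (opNorm_Lc_le N R M hR) (norm_nonneg _)
            (by rw [mul_one]; exact hs)
      _ = (Real.sqrt ((R : ℝ) ^ d))⁻¹ := by ring
  calc ‖Qc N R M T Rl‖ ^ 2 ≤ ((Real.sqrt ((R : ℝ) ^ d))⁻¹) ^ 2 := pow_le_pow_left₀ (norm_nonneg _) h1 2
    _ = ((R : ℝ) ^ d)⁻¹ := by rw [inv_pow, Real.sq_sqrt hRd.le]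

omit [NeZero N] [NeZero R] hM in
/-- pointwise: `‖T·R − 1‖ ≤ α + β` from `‖T − 1‖ ≤ α`, `‖R‖ ≤ 1`, `‖R − 1‖ ≤ β`. [folklore] -/
theorem norm_mul_sub_one_le {Tx Rx : Matrix o o ℂ} {α β : ℝ} (hα : 0 ≤ α) (hT : ‖Tx - 1‖ ≤ α) (hR : ‖Rx‖ ≤ 1) (hR1 : ‖Rx - 1‖ ≤ β) :
    ‖Tx * Rx - 1‖ ≤ α + β := by
  have e : Tx * Rx - 1 = (Tx - 1) * Rx + (Rx - 1) := by rw [Matrix.sub_mul, Matrix.one_mul]; abel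
  rw [e]
  calc _ ≤ ‖(Tx - 1) * Rx‖ + ‖Rx - 1‖ := norm_add_le _ _
    _ ≤ α * 1 + β := add_le_add ((Matrix.l2_opNorm_mul _ _).trans (mul_le_mul hT hR (norm_nonneg _) hα)) hR1
    _ = α + β := by ring

/-- **`‖Lc Rl′ − Lc Rl‖ ≤ γ`** when the line transporters differ pointwise by at most `γ`. [folklore] -/
theorem opNorm_Lc_sub_Lc_le {Rl Rl' : Fin R → Tor (fine (R * N) M) × Fin d → Matrix o o ℂ} {γ : ℝ} (hγ : 0 ≤ γ)
    (hR : ∀ t x, ‖Rl' t x - Rl t x‖ ≤ γ) : ‖Lc N R M Rl' - Lc N R M Rl‖ ≤ γ := by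
  have hRpos : (0 : ℝ) < R := by exact_mod_cast Nat.pos_of_ne_zero (NeZero.ne R)
  have e2 : Lc N R M Rl' - Lc N R M Rl
      = ((R : ℂ))⁻¹ • ∑ t : Fin R, siteMul (fun x => Rl' t x - Rl t x) * (shiftT (fine (R * N) M) (t : ℕ) ⊗ₖ (1 : Matrix o o ℂ)) := by
    rw [Lc, Lc, ← smul_sub, ← Finset.sum_sub_distrib]
    congr 1
    refine Finset.sum_congr rfl fun t _ => ?_
    rw [siteMul_sub, Matrix.sub_mul]
  rw [e2, norm_smul, norm_inv, Complex.norm_natCast]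
  calc (R : ℝ)⁻¹ * ‖∑ t : Fin R, siteMul (fun x => Rl' t x - Rl t x) * shiftT (fine (R * N) M) (t : ℕ) ⊗ₖ (1 : Matrix o o ℂ)‖
      ≤ (R : ℝ)⁻¹ * ∑ t : Fin R, ‖siteMul (fun x => Rl' t x - Rl t x) * shiftT (fine (R * N) M) (t : ℕ) ⊗ₖ (1 : Matrix o o ℂ)‖ :=
        mul_le_mul_of_nonneg_left (norm_sum_le _ _) (inv_nonneg.mpr hRpos.le)
    _ ≤ (R : ℝ)⁻¹ * ∑ _t : Fin R, γ := by
        refine mul_le_mul_of_nonneg_left (Finset.sum_le_sum fun t _ => ?_) (inv_nonneg.mpr hRpos.le)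
        calc _ ≤ ‖siteMul (fun x => Rl' t x - Rl t x)‖ * ‖shiftT (fine (R * N) M) (t : ℕ) ⊗ₖ (1 : Matrix o o ℂ)‖ :=
              Matrix.l2_opNorm_mul _ _
          _ ≤ γ * 1 := mul_le_mul (opNorm_siteMul_le _ hγ (hR t)) (opNorm_kron_le_of_le o (BalabanLineAverage.opNorm_shiftT_le _ _))
              (norm_nonneg _) hγ
          _ = γ := mul_one _
    _ = γ := by
        rw [Finset.sum_const, Finset.card_univ, Fintype.card_fin, nsmul_eq_mul, ← mul_assoc, inv_mul_cancel₀ hRpos.ne', one_mul]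

/-- **TWO SETS OF TRANSPORT DATA: `‖√(R^d)•(Qc T′ Rl′ − Qc T Rl)‖ ≤ β + γ`** (`‖T′ − T‖∞ ≤ β`, `‖T‖∞ ≤ 1`, `‖Rl′‖∞ ≤ 1`, `‖Rl′ − Rl‖∞ ≤ γ`) —
the one-step covariant averagings of two backgrounds differ by the size of the difference of their transporters. [folklore] -/
theorem opNorm_sqrt_smul_Qc_sub_Qc_le {T T' : Tor (fine (R * N) M) × Fin d → Matrix o o ℂ}
    {Rl Rl' : Fin R → Tor (fine (R * N) M) × Fin d → Matrix o o ℂ} {β γ : ℝ} (hβ : 0 ≤ β) (hγ : 0 ≤ γ)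
    (hT : ∀ x, ‖T' x - T x‖ ≤ β) (hTn : ∀ x, ‖T x‖ ≤ 1) (hR' : ∀ t x, ‖Rl' t x‖ ≤ 1) (hR : ∀ t x, ‖Rl' t x - Rl t x‖ ≤ γ) :
    ‖(((Real.sqrt ((R : ℝ) ^ d) : ℝ) : ℂ)) • (Qc N R M T' Rl' - Qc N R M T Rl)‖ ≤ β + γ := by
  have hRpos : (0 : ℝ) < R := by exact_mod_cast Nat.pos_of_ne_zero (NeZero.ne R)
  have hRd : (0 : ℝ) < (R : ℝ) ^ d := pow_pos hRpos d
  have hs0 : 0 < Real.sqrt ((R : ℝ) ^ d) := Real.sqrt_pos.mpr hRd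
  have e : Qc N R M T' Rl' - Qc N R M T Rl
      = Qavg N R M ⊗ₖ (1 : Matrix o o ℂ) * (siteMul (fun x => T' x - T x) * Lc N R M Rl' + siteMul T * (Lc N R M Rl' - Lc N R M Rl)) := by
    rw [Qc, Qc, siteMul_sub]
    simp only [Matrix.mul_add, Matrix.mul_sub, Matrix.sub_mul, Matrix.mul_assoc]
    abel
  have h1 : ‖siteMul (fun x => T' x - T x) * Lc N R M Rl'‖ ≤ β :=
    (Matrix.l2_opNorm_mul _ _).trans ((mul_le_mul (opNorm_siteMul_le _ hβ hT) (opNorm_Lc_le N R M hR') (norm_nonneg _) hβ).trans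
      (le_of_eq (mul_one _)))
  have h2 : ‖siteMul T * (Lc N R M Rl' - Lc N R M Rl)‖ ≤ γ :=
    (Matrix.l2_opNorm_mul _ _).trans ((mul_le_mul (opNorm_siteMul_le _ zero_le_one hTn) (opNorm_Lc_sub_Lc_le N R M hγ hR)
      (norm_nonneg _) zero_le_one).trans (le_of_eq (one_mul _)))
  rw [e, norm_smul, Complex.norm_real, Real.norm_of_nonneg hs0.le]
  calc Real.sqrt ((R : ℝ) ^ d) * ‖Qavg N R M ⊗ₖ (1 : Matrix o o ℂ)
          * (siteMul (fun x => T' x - T x) * Lc N R M Rl' + siteMul T * (Lc N R M Rl' - Lc N R M Rl))‖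
      ≤ Real.sqrt ((R : ℝ) ^ d) * ((Real.sqrt ((R : ℝ) ^ d))⁻¹ * (β + γ)) := by
        refine mul_le_mul_of_nonneg_left ((Matrix.l2_opNorm_mul _ _).trans (mul_le_mul (opNorm_kron_le_of_le o (opNorm_Qavg_le N R M))
          ((norm_add_le _ _).trans (add_le_add h1 h2)) (norm_nonneg _) (inv_nonneg.mpr hs0.le))) hs0.le
    _ = β + γ := by field_simp

/-- **ONE STEP: `‖√(R^d)•(Qc T Rl − QB ⊗ 1)‖ ≤ α + β`** (`‖T − 1‖∞ ≤ α`, line transporters contractions with `‖Rl t − 1‖∞ ≤ β`):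
the one-step covariant averaging differs from Bałaban's free `QB ⊗ 1` by the size of the transporters' deviation from `1` — GEOMETRIC
in the level when the transporters are. [folklore] -/
theorem opNorm_sqrt_smul_Qc_sub_le {T : Tor (fine (R * N) M) × Fin d → Matrix o o ℂ}
    {Rl : Fin R → Tor (fine (R * N) M) × Fin d → Matrix o o ℂ} {α β : ℝ} (hα : 0 ≤ α) (hβ : 0 ≤ β)
    (hT1 : ∀ x, ‖T x - 1‖ ≤ α) (hR : ∀ t x, ‖Rl t x‖ ≤ 1) (hR1 : ∀ t x, ‖Rl t x - 1‖ ≤ β) :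
    ‖(((Real.sqrt ((R : ℝ) ^ d) : ℝ) : ℂ)) • (Qc N R M T Rl - QB N R M ⊗ₖ (1 : Matrix o o ℂ))‖ ≤ α + β := by
  rw [← Qc_one_one N R M]
  exact opNorm_sqrt_smul_Qc_sub_Qc_le N R M hα hβ hT1 (fun _ => CovariantAveragingTower.opNorm_one_le (ι := fun _ => o) 0) hR hR1

variable {σ : Type*} [Fintype σ] [DecidableEq σ]

omit [Fintype σ] [DecidableEq σ] in
/-- **THE TWO-LEVEL IDENTITY** behind the sandwiched pairing of the transport error: for any left factors `Bx` (the covariant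
composite so far) and `Bb` (the free composite so far),
`(Bx·√•Qc − Bb·√•(QB ⊗ 1))·(J ⊗ 1) − (Bx − Bb) = Bx·siteMul(T̄ − 1) + ((Bx − Bb)·siteMul W + Bb·siteMul(W − W⁰))·((S_1 − 1) ⊗ 1)`.
[folklore] -/
theorem twoLevel_identity (Bx Bb : Matrix σ ((Tor (fine N M) × Fin d) × o) ℂ) (T : Tor (fine (R * N) M) × Fin d → Matrix o o ℂ)
    (Rl : Fin R → Tor (fine (R * N) M) × Fin d → Matrix o o ℂ) :
    (Bx * ((((Real.sqrt ((R : ℝ) ^ d) : ℝ) : ℂ)) • Qc N R M T Rl)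
        - Bb * ((((Real.sqrt ((R : ℝ) ^ d) : ℝ) : ℂ)) • (QB N R M ⊗ₖ (1 : Matrix o o ℂ)))) * (JK N R M ⊗ₖ (1 : Matrix o o ℂ))
      - (Bx - Bb)
      = Bx * siteMul (fun i => Tgen N R M (fun t x => T x * Rl t x) i - 1)
        + ((Bx - Bb) * siteMul (Wgen N R M (fun t x => T x * Rl t x))
            + Bb * siteMul (fun i => Wgen N R M (fun t x => T x * Rl t x) i
                - Wgen N R M (fun (_ : Fin R) (_ : Tor (fine (R * N) M) × Fin d) => (1 : Matrix o o ℂ)) i))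
          * ((shiftT (fine N M) 1 - 1) ⊗ₖ (1 : Matrix o o ℂ)) := by
  set J1 := JK N R M ⊗ₖ (1 : Matrix o o ℂ)
  set X := (shiftT (fine N M) 1 - 1) ⊗ₖ (1 : Matrix o o ℂ)
  set s : ℂ := (((Real.sqrt ((R : ℝ) ^ d) : ℝ) : ℂ))
  have hx : Bx * (s • Qc N R M T Rl) * J1
      = Bx * (siteMul (Tgen N R M (fun t x => T x * Rl t x)) + siteMul (Wgen N R M (fun t x => T x * Rl t x)) * X) := by
    rw [Matrix.mul_assoc, Matrix.smul_mul, sqrt_smul_Qc_mul_kronJK]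
  have hone : (fun (t : Fin R) (x : Tor (fine (R * N) M) × Fin d) => (1 : Matrix o o ℂ) * (1 : Matrix o o ℂ))
      = fun (_ : Fin R) (_ : Tor (fine (R * N) M) × Fin d) => (1 : Matrix o o ℂ) := by
    funext t x; rw [Matrix.mul_one]
  have hT1 : siteMul (Tgen N R M (fun (_ : Fin R) (_ : Tor (fine (R * N) M) × Fin d) => (1 : Matrix o o ℂ)))
      = (1 : Matrix ((Tor (fine N M) × Fin d) × o) ((Tor (fine N M) × Fin d) × o) ℂ) := by
    have e : Tgen N R M (fun (_ : Fin R) (_ : Tor (fine (R * N) M) × Fin d) => (1 : Matrix o o ℂ)) = fun _ => 1 :=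
      funext fun i => Tgen_one N R M i
    rw [e, siteMul_one]
  have hb : Bb * (s • (QB N R M ⊗ₖ (1 : Matrix o o ℂ))) * J1
      = Bb * (1 + siteMul (Wgen N R M (fun (_ : Fin R) (_ : Tor (fine (R * N) M) × Fin d) => (1 : Matrix o o ℂ))) * X) := by
    rw [Matrix.mul_assoc, Matrix.smul_mul, ← Qc_one_one N R M, sqrt_smul_Qc_mul_kronJK, hone, hT1]
  rw [Matrix.sub_mul, hx, hb, siteMul_sub, siteMul_sub, siteMul_one]
  simp only [Matrix.mul_sub, Matrix.sub_mul, Matrix.mul_add, Matrix.add_mul, Matrix.mul_one, Matrix.mul_assoc]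
  abel

omit [DecidableEq σ] in
/-- **THE SANDWICHED TWO-LEVEL BOUND**: with `‖Bx‖, ‖Bb‖ ≤ 1`, `‖Bx − Bb‖ ≤ ε`, transport data `‖T − 1‖∞ ≤ α`, `‖T‖∞, ‖Rl‖∞ ≤ 1`,
`‖Rl − 1‖∞ ≤ β`, and the free propagator `𝒢 = calG N` ((1.89): `‖∇_μ𝒢‖ ≤ Cst`):
`‖((Bx·√•Qc − Bb·√•(QB ⊗ 1))·(J ⊗ 1) − (Bx − Bb))·(𝒢 ⊗ 1)‖ ≤ (α + β)·Cst + (ε + (α + β))·(d·Cst/N)`.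
[cite: Balaban1984PropagatorsI, Prop. 1.1 (1.89) p.33] [folklore] -/
theorem twoLevel_bound (hN : 1 ≤ N) (a : ℝ) (ha : 0 < a) {Bx Bb : Matrix σ ((Tor (fine N M) × Fin d) × o) ℂ} {ε : ℝ}
    (hBx : ‖Bx‖ ≤ 1) (hBb : ‖Bb‖ ≤ 1) (hE : ‖Bx - Bb‖ ≤ ε) {T : Tor (fine (R * N) M) × Fin d → Matrix o o ℂ}
    {Rl : Fin R → Tor (fine (R * N) M) × Fin d → Matrix o o ℂ} {α β : ℝ} (hα : 0 ≤ α) (hβ : 0 ≤ β) (hT : ∀ x, ‖T x‖ ≤ 1)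
    (hT1 : ∀ x, ‖T x - 1‖ ≤ α) (hR : ∀ t x, ‖Rl t x‖ ≤ 1) (hR1 : ∀ t x, ‖Rl t x - 1‖ ≤ β) :
    ‖((Bx * ((((Real.sqrt ((R : ℝ) ^ d) : ℝ) : ℂ)) • Qc N R M T Rl)
        - Bb * ((((Real.sqrt ((R : ℝ) ^ d) : ℝ) : ℂ)) • (QB N R M ⊗ₖ (1 : Matrix o o ℂ)))) * (JK N R M ⊗ₖ (1 : Matrix o o ℂ))
        - (Bx - Bb)) * (calG N hN M a ha ⊗ₖ (1 : Matrix o o ℂ))‖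
      ≤ (α + β) * Cst d a + (ε + (α + β)) * (d * (Cst d a / N)) := by
  have hC := Cst_nonneg d a
  have hNc : ((N : ℕ) : ℂ) ≠ 0 := by exact_mod_cast (Nat.pos_iff_ne_zero.mp hN)
  have hε : 0 ≤ ε := (norm_nonneg _).trans hE
  set v : Fin R → Tor (fine (R * N) M) × Fin d → Matrix o o ℂ := fun t x => T x * Rl t x
  have hv1 : ∀ t x, ‖v t x - 1‖ ≤ α + β := fun t x => norm_mul_sub_one_le hα (hT1 x) (hR t x) (hR1 t x)
  have hv : ∀ t x, ‖v t x‖ ≤ 1 := fun t x =>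
    (Matrix.l2_opNorm_mul _ _).trans ((mul_le_mul (hT x) (hR t x) (norm_nonneg _) zero_le_one).trans (le_of_eq (one_mul 1)))
  -- the pieces
  have hTg : ‖siteMul (fun i => Tgen N R M v i - 1)‖ ≤ α + β :=
    opNorm_siteMul_le _ (add_nonneg hα hβ) fun i => norm_Tgen_sub_one_le N R M hv1 i
  have hWg : ‖siteMul (Wgen N R M v)‖ ≤ 1 := opNorm_siteMul_le _ zero_le_one fun i => norm_Wgen_le N R M hv i
  have hWd : ‖siteMul (fun i => Wgen N R M v i - Wgen N R M (fun (_ : Fin R) (_ : Tor (fine (R * N) M) × Fin d) => (1 : Matrix o o ℂ)) i)‖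
      ≤ α + β := opNorm_siteMul_le _ (add_nonneg hα hβ) fun i => norm_Wgen_sub_Wgen_one_le N R M hv1 i
  have hG : ‖calG N hN M a ha ⊗ₖ (1 : Matrix o o ℂ)‖ ≤ Cst d a := opNorm_kron_le_of_le o (opNorm_calG_le N hN M a ha)
  have hXG : ‖(shiftT (fine N M) 1 - 1) ⊗ₖ (1 : Matrix o o ℂ) * (calG N hN M a ha ⊗ₖ (1 : Matrix o o ℂ))‖ ≤ d * (Cst d a / N) := by
    rw [← kron_mul]
    refine opNorm_kron_le_of_le o ?_
    have h := BalabanLineAverage.opNorm_shiftT_one_sub_one_mul_le (fine N M) (calG N hN M a ha) hNc (opNorm_fdiff_calG_le N hN M a ha)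
    rwa [Complex.norm_natCast] at h
  have hdN : 0 ≤ d * (Cst d a / N) := by positivity
  rw [twoLevel_identity, Matrix.add_mul]
  refine (norm_add_le _ _).trans (add_le_add ?_ ?_)
  · calc _ ≤ ‖Bx * siteMul (fun i => Tgen N R M v i - 1)‖ * ‖calG N hN M a ha ⊗ₖ (1 : Matrix o o ℂ)‖ := Matrix.l2_opNorm_mul _ _
      _ ≤ (1 * (α + β)) * Cst d a := mul_le_mul ((Matrix.l2_opNorm_mul _ _).trans (mul_le_mul hBx hTg (norm_nonneg _) zero_le_one))
          hG (norm_nonneg _) (by rw [one_mul]; exact add_nonneg hα hβ)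
      _ = (α + β) * Cst d a := by rw [one_mul]
  · rw [Matrix.mul_assoc]
    calc _ ≤ ‖(Bx - Bb) * siteMul (Wgen N R M v) + Bb * siteMul (fun i => Wgen N R M v i
              - Wgen N R M (fun (_ : Fin R) (_ : Tor (fine (R * N) M) × Fin d) => (1 : Matrix o o ℂ)) i)‖
            * ‖(shiftT (fine N M) 1 - 1) ⊗ₖ (1 : Matrix o o ℂ) * (calG N hN M a ha ⊗ₖ (1 : Matrix o o ℂ))‖ := Matrix.l2_opNorm_mul _ _
      _ ≤ (ε * 1 + 1 * (α + β)) * (d * (Cst d a / N)) := by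
          refine mul_le_mul ((norm_add_le _ _).trans (add_le_add ?_ ?_)) hXG (norm_nonneg _) (by positivity)
          · exact (Matrix.l2_opNorm_mul _ _).trans (mul_le_mul hE hWg (norm_nonneg _) hε)
          · exact (Matrix.l2_opNorm_mul _ _).trans (mul_le_mul hBb hWd (norm_nonneg _) zero_le_one)
      _ = (ε + (α + β)) * (d * (Cst d a / N)) := by ring

/-- the same bound for the LEFT sandwich `‖(𝒢 ⊗ 1)·(…)ᴴ‖` (`𝒢` Hermitian). [cite: Balaban1984PropagatorsI, Prop. 1.1 (1.89) p.33] [folklore] -/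
theorem twoLevel_bound_left (hN : 1 ≤ N) (a : ℝ) (ha : 0 < a) {Bx Bb : Matrix σ ((Tor (fine N M) × Fin d) × o) ℂ} {ε : ℝ}
    (hBx : ‖Bx‖ ≤ 1) (hBb : ‖Bb‖ ≤ 1) (hE : ‖Bx - Bb‖ ≤ ε) {T : Tor (fine (R * N) M) × Fin d → Matrix o o ℂ}
    {Rl : Fin R → Tor (fine (R * N) M) × Fin d → Matrix o o ℂ} {α β : ℝ} (hα : 0 ≤ α) (hβ : 0 ≤ β) (hT : ∀ x, ‖T x‖ ≤ 1)
    (hT1 : ∀ x, ‖T x - 1‖ ≤ α) (hR : ∀ t x, ‖Rl t x‖ ≤ 1) (hR1 : ∀ t x, ‖Rl t x - 1‖ ≤ β) :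
    ‖(calG N hN M a ha ⊗ₖ (1 : Matrix o o ℂ)) * ((Bx * ((((Real.sqrt ((R : ℝ) ^ d) : ℝ) : ℂ)) • Qc N R M T Rl)
        - Bb * ((((Real.sqrt ((R : ℝ) ^ d) : ℝ) : ℂ)) • (QB N R M ⊗ₖ (1 : Matrix o o ℂ)))) * (JK N R M ⊗ₖ (1 : Matrix o o ℂ))
        - (Bx - Bb))ᴴ‖
      ≤ (α + β) * Cst d a + (ε + (α + β)) * (d * (Cst d a / N)) := by
  have hH : (calG N hN M a ha ⊗ₖ (1 : Matrix o o ℂ))ᴴ = calG N hN M a ha ⊗ₖ (1 : Matrix o o ℂ) := by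
    rw [kron_conjTranspose, (calG_isHermitian N hN M a ha).eq]
  rw [← Matrix.l2_opNorm_conjTranspose, Matrix.conjTranspose_mul, Matrix.conjTranspose_conjTranspose, hH]
  exact twoLevel_bound N R M hN a ha hBx hBb hE hα hβ hT hT1 hR hR1

end Norms




end Summit.QuantumFields.BalabanUV.T4Continuum.CovariantLineAveraging

end
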